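import Summits.BirchSwinnertonDyer.BirchSwinnertonDyer.Theorems.GenusKolyvaginAtTwoGenusPrimitiveSupplyAtTwoHabitatCutStubA
import Summits.BirchSwinnertonDyer.BirchSwinnertonDyer.Theorems.GenusKolyvaginAtTwoGenusPrimitiveSupplyAtTwoHabitatCutReach
import Summits.BirchSwinnertonDyer.BirchSwinnertonDyer.Theorems.GenusKolyvaginAtTwoPowDvdShaCardAtTwoRTGenusParity
import HarnessLib

/-!
# Route `GenusKolyvaginAtTwo`, crux #2 `GenusPrimitiveSupplyAtTwo` (stmt-BirchSwinnertonDyer-22136), line `genus_supply`: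
# THE REPAIRED STUB A (v2.1 = v2 + `Odd W.tamagawaProduct`) ON THE (E1) REACH, BY NAME

Width seat `bsd-line-gk2-p5` g25 (cell `bsd-f1-sign2`, SUPPLY lineage), companion of `…GenusPrimitiveSupplyAtTwoStubATamagawaGuard`
(which shows the v2 text — guard `ord₂ C(Wd) ≤ 2` without `Odd W.tamagawaProduct` — is refutable from the tree). THEOREMS ONLY;
helper `--supports stmt-BirchSwinnertonDyer-22136`; no item is closed; BSD is not proved by any of this.

* §1 `stub_minimalTwinSupplyAtTwo_v2_1_onReach_of_twoConverse` — the v2.1 conclusion (Heegner `K` with odd `d_K ≠ −3`, the two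
  non-square clauses, a globally minimal twin `Wd ≅ W^{(d_K)}` with `r_an(Wd) = 1`, `#Sel₂(Wd) = 2`, `ord₂ C(Wd) ≤ 2`) for `W` non-CM,
  `r_an(W) = 0`, `2`-adic tower onto, `C(W)` odd, ON THE REACH `Δ_W < 0`, `#Sel₂(W) ∈ {1, 4}`, modulo {Modularity, `2`-parity
  (elliptic form), CONV₂}: re-export of gk2-p5 g20's `GenusKolyTwistingPrime.stub_minimalTwinSupplyAtTwo_genusBudget_one_of_twoConverse`
  (there the guard is sharp, `ord₂ C(Wd) = 1`).
* §2 THE REACH OF v2.1 AS A THEOREM ABOUT ITS TEXT: `natCard_selmerGroup_two_dvd_four_of_stubA_v2_1` — the v2.1 text implies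
  `#Sel₂(W) ∣ 4` for EVERY non-CM analytic-rank-`0` full-`2`-tower `W` with `C(W)` odd, `Δ_W < 0` and `2 ∣ N_W` (genus parity
  `PlusDescent.odd_padicValNat_two_tamagawaProduct_twin_of_Δ_neg` makes the guard `= 1`; then gk2-p5 g20's
  `natCard_selmerGroup_two_dvd_four_of_genusBudget_one_of_two_dvd_conductorNorm` = Mazur–Rubin Prop. 3.3, a tree theorem); hence
  `stub_minimalTwinSupplyAtTwo_v2_1_false_of_exists` — v2.1 is false as soon as ONE such curve has `#Sel₂(W) ∤ 4` (rank `0`,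
  `W(ℚ)[2] = 0`: `dim Ш(W)[2] ≥ 3`). This is the (H1)/(E1) scope question of director (347) made formal: the corrected stub needs the
  cut `#Sel₂(W) ∣ 4` (equivalently `dim Sel₂(W) ≤ 2`) in its hypotheses, or the crux's habitat does.

References: [MazurRubin2010] Thm. 2.7, Prop. 3.3, Cor. 3.4 (i); [Kramer1981] §2 Prop. 3; [DokchitserDokchitserAnnals2010] Thm. 1.4;
[GrossLMS1991] §1.
-/

set_option linter.dupNamespace false -- tree convention: `Summit.BirchSwinnertonDyer.BirchSwinnertonDyer.Theorems` (summit = sub-problem)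
set_option autoImplicit false

noncomputable section

open scoped Classical

namespace Summit.BirchSwinnertonDyer.BirchSwinnertonDyer.Theorems.GenusKolyTwin

open WeierstrassCurve NumberField Literature.NumberTheory.EllipticCurves

/-! ## §1 The repaired stub on the (E1) reach -/

/-- **THE REPAIRED STUB A (v2.1) ON THE (E1) REACH, modulo Modularity, `2`-parity (elliptic form) and the rank-one `2`-converse
(CONV₂).** The corrected signature is the v2 signature with `Odd W.tamagawaProduct →` inserted after the tower binder (the
composition `GenusPrimitiveSupplyAtTwo_of` holds that hypothesis; stub C already takes it). On the sub-frame `Δ_W < 0`,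
`#Sel₂(W) ∈ {1, 4}` the SUPPLY delivers it with the guard in its sharp form `ord₂ C(Wd) = 1 ≤ 2`: this is gk2-p5 g20's
`GenusKolyTwistingPrime.stub_minimalTwinSupplyAtTwo_genusBudget_one_of_twoConverse` (prime Heegner field `ℚ(√−ℓ)`, `ℓ ≡ 7 (8)`,
unconditional supply `GenusKolyPR.supply_DEF1_minimalTwin_habitat` + gk2-p2's `padicValNat_two_tamagawaProduct_twin_eq_one_of_prime`),
re-exported in the LETTER of the v2.1 conclusion. Conditional exactly like the LEAD's v4/v5 reductions of stub A (Modularity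
`exists_isNewformOf`, `∀ V [V.IsElliptic], p_parity V 2`, CONV₂ displayed); beyond `dim Sel₂(W) ≤ 2` the corrected stub is NOT
claimed (reach recorded in `GenusKolyTwin.natCard_selmerGroup_two_dvd_four_of_genusBudget_one`). BSD is not proved by this.
[cite: MazurRubin2010, Thm. 2.7, Prop. 3.3, Cor. 3.4 (i)] [cite: Kramer1981, §2 Prop. 3] [cite: DokchitserDokchitserAnnals2010, Thm. 1.4]
[cite: GrossLMS1991, §1 (p. 235)] -/
theorem stub_minimalTwinSupplyAtTwo_v2_1_onReach_of_twoConverse (hmod : ModularForms.exists_isNewformOf)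
    (hpar : ∀ (V : WeierstrassCurve ℚ) [V.IsElliptic], p_parity V 2)
    (hconv : ∀ (V : WeierstrassCurve ℚ) [V.IsElliptic] [V.IsGloballyMinimal],
      ¬ V.HasCM → V.selmerCorank 2 = 1 → V.analyticRank = 1)
    (W : WeierstrassCurve ℚ) [W.IsElliptic] [W.IsGloballyMinimal]
    (hcm : ¬ W.HasCM) (hr0 : W.analyticRank = 0) (hρ : ∀ n : ℕ, 0 < n → W.HasSurjectiveModNGaloisRep ((2 : ℤ) ^ n))
    (hT : Odd W.tamagawaProduct) (hΔ : W.Δ < 0)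
    (h14 : Nat.card (W.selmerGroup 2) = 1 ∨ Nat.card (W.selmerGroup 2) = 4) :
    ∃ (K : Type) (_ : Field K) (_ : NumberField K),
      IsImaginaryQuadratic K ∧ Odd (NumberField.discr K) ∧ NumberField.discr K ≠ -3 ∧
      SatisfiesHeegnerHypothesis (W.conductorNorm ℤ) K ∧
      ¬ IsSquare ((NumberField.discr K : ℚ) * -|W.Δ|) ∧ ¬ IsSquare ((NumberField.discr K : ℚ) * (-(2 * |W.Δ|))) ∧
      ∃ (Wd : WeierstrassCurve ℚ) (_ : Wd.IsElliptic) (_ : Wd.IsGloballyMinimal),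
        (∃ C : WeierstrassCurve.VariableChange ℚ, C • W.quadraticTwist (NumberField.discr K : ℚ) = Wd) ∧
        Wd.analyticRank = 1 ∧ Nat.card (Wd.selmerGroup 2) = 2 ∧ padicValNat 2 Wd.tamagawaProduct ≤ 2 := by
  obtain ⟨ℓ, -, -, -, K, _, _, hK, -, hodd, h3, hH, hs1, hs2, -, Wd, _, _, hWd, -, hr1, hSel, hB⟩ :=
    GenusKolyTwistingPrime.stub_minimalTwinSupplyAtTwo_genusBudget_one_of_twoConverse hmod hpar hconv W hcm hr0 hρ hΔ hT h14
  exact ⟨K, inferInstance, inferInstance, hK, hodd, h3, hH, hs1, hs2, Wd, inferInstance, inferInstance, hWd, hr1, hSel,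
    hB.le.trans one_le_two⟩

/-! ## §2 The reach of the corrected stub, as a theorem about its text -/

/-- **THE v2.1 TEXT FORCES `#Sel₂(W) ∣ 4` ON `Δ_W < 0`, `2 ∣ N_W`.** If the corrected stub A (v2 + `Odd W.tamagawaProduct`) holds,
then every non-CM `W` with `r_an(W) = 0`, surjective `2`-adic tower, `C(W)` odd, `Δ_W < 0` and `2 ∣ N_W` has `#Sel₂(W) ∣ 4`: for the
Heegner field `K` and twin `Wd` the stub returns, `ord₂ C(Wd)` is ODD (`PlusDescent.odd_padicValNat_two_tamagawaProduct_twin_of_Δ_neg`,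
reciprocity parity of the genus budget), so the guard `≤ 2` reads `= 1`, `2` splits in `K` (Heegner, `2 ∣ N_W`), and Mazur–Rubin
Prop. 3.3 at the single transposition prime of `d_K` (`natCard_selmerGroup_two_dvd_four_of_genusBudget_one_of_two_dvd_conductorNorm`)
gives `#Sel₂(W) ∣ 2·#Sel₂(Wd) = 4`. [cite: MazurRubin2010, Prop. 3.3 with Lemma 2.2 (i)] [cite: Kramer1981, §2 Prop. 3]
[cite: IrelandRosen1990, Prop. 5.2.2] -/
theorem natCard_selmerGroup_two_dvd_four_of_stubA_v2_1
    (h : ∀ (W : WeierstrassCurve ℚ) [W.IsElliptic] [W.IsGloballyMinimal] [NeZero (W.conductorNorm ℤ)],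
        ¬ W.HasCM → W.analyticRank = 0 → (∀ n : ℕ, 0 < n → W.HasSurjectiveModNGaloisRep ((2 : ℤ) ^ n)) →
        Odd W.tamagawaProduct →
        ∃ (K : Type) (_ : Field K) (_ : NumberField K),
          IsImaginaryQuadratic K ∧ Odd (NumberField.discr K) ∧ NumberField.discr K ≠ -3 ∧
          SatisfiesHeegnerHypothesis (W.conductorNorm ℤ) K ∧
          ¬ IsSquare ((NumberField.discr K : ℚ) * -|W.Δ|) ∧ ¬ IsSquare ((NumberField.discr K : ℚ) * (-(2 * |W.Δ|))) ∧
          ∃ (Wd : WeierstrassCurve ℚ) (_ : Wd.IsElliptic) (_ : Wd.IsGloballyMinimal),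
            (∃ C : WeierstrassCurve.VariableChange ℚ, C • W.quadraticTwist (NumberField.discr K : ℚ) = Wd) ∧
            Wd.analyticRank = 1 ∧ Nat.card (Wd.selmerGroup 2) = 2 ∧ padicValNat 2 Wd.tamagawaProduct ≤ 2)
    (W : WeierstrassCurve ℚ) [W.IsElliptic] [W.IsGloballyMinimal] [NeZero (W.conductorNorm ℤ)]
    (hcm : ¬ W.HasCM) (hr0 : W.analyticRank = 0) (hρ : ∀ n : ℕ, 0 < n → W.HasSurjectiveModNGaloisRep ((2 : ℤ) ^ n))
    (hT : Odd W.tamagawaProduct) (hΔ : W.Δ < 0) (hN2 : 2 ∣ W.conductorNorm ℤ) :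
    Nat.card (W.selmerGroup 2) ∣ 4 := by
  obtain ⟨K, _, _, hK, hodd, -, hH, -, -, Wd, _, _, ⟨Cd, hCd⟩, -, hSel, hle⟩ := h W hcm hr0 hρ hT
  have hpar := GenusExact.PlusDescent.odd_padicValNat_two_tamagawaProduct_twin_of_Δ_neg W hK hodd hH hT hΔ Cd hCd
  have hB : padicValNat 2 Wd.tamagawaProduct = 1 := by
    obtain ⟨k, hk⟩ := hpar
    omega
  exact natCard_selmerGroup_two_dvd_four_of_genusBudget_one_of_two_dvd_conductorNorm W hΔ hT hN2 hK hodd hH Wd ⟨Cd, hCd⟩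
    hSel hB

/-- **THE CORRECTED STUB IS STILL FALSE OFF THE (E1) REACH**: if SOME non-CM `W` with `r_an(W) = 0`, surjective `2`-adic tower,
`C(W)` odd, `Δ_W < 0`, `2 ∣ N_W` has `#Sel₂(W) ∤ 4` (for such `W`, rank `0` and `W(ℚ)[2] = 0`, this says `dim_𝔽₂ Ш(W)[2] ≥ 3`),
then the v2.1 text is false (`natCard_selmerGroup_two_dvd_four_of_stubA_v2_1`). The existence clause is displayed (not computable
in the tree); it is the habitat cut (H1)/(E1) of director (347) which the corrected stub must therefore CARRY — e.g. as the binder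
`Nat.card (W.selmerGroup 2) ∣ 4` — unless the crux's habitat does. [cite: MazurRubin2010, Prop. 3.3 with Lemma 2.2 (i)]
[cite: Kramer1981, §2 Prop. 3] -/
theorem stub_minimalTwinSupplyAtTwo_v2_1_false_of_exists
    (H : ∃ (W : WeierstrassCurve ℚ) (_ : W.IsElliptic) (_ : W.IsGloballyMinimal) (_ : NeZero (W.conductorNorm ℤ)),
      ¬ W.HasCM ∧ W.analyticRank = 0 ∧ (∀ n : ℕ, 0 < n → W.HasSurjectiveModNGaloisRep ((2 : ℤ) ^ n)) ∧
        Odd W.tamagawaProduct ∧ W.Δ < 0 ∧ 2 ∣ W.conductorNorm ℤ ∧ ¬ Nat.card (W.selmerGroup 2) ∣ 4) :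
    ¬ (∀ (W : WeierstrassCurve ℚ) [W.IsElliptic] [W.IsGloballyMinimal] [NeZero (W.conductorNorm ℤ)],
        ¬ W.HasCM → W.analyticRank = 0 → (∀ n : ℕ, 0 < n → W.HasSurjectiveModNGaloisRep ((2 : ℤ) ^ n)) →
        Odd W.tamagawaProduct →
        ∃ (K : Type) (_ : Field K) (_ : NumberField K),
          IsImaginaryQuadratic K ∧ Odd (NumberField.discr K) ∧ NumberField.discr K ≠ -3 ∧
          SatisfiesHeegnerHypothesis (W.conductorNorm ℤ) K ∧
          ¬ IsSquare ((NumberField.discr K : ℚ) * -|W.Δ|) ∧ ¬ IsSquare ((NumberField.discr K : ℚ) * (-(2 * |W.Δ|))) ∧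
          ∃ (Wd : WeierstrassCurve ℚ) (_ : Wd.IsElliptic) (_ : Wd.IsGloballyMinimal),
            (∃ C : WeierstrassCurve.VariableChange ℚ, C • W.quadraticTwist (NumberField.discr K : ℚ) = Wd) ∧
            Wd.analyticRank = 1 ∧ Nat.card (Wd.selmerGroup 2) = 2 ∧ padicValNat 2 Wd.tamagawaProduct ≤ 2) := by
  intro h
  obtain ⟨W, _, _, _, hcm, hr0, hρ, hT, hΔ, hN2, hSel⟩ := H
  exact hSel (natCard_selmerGroup_two_dvd_four_of_stubA_v2_1 h W hcm hr0 hρ hT hΔ hN2)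

end Summit.BirchSwinnertonDyer.BirchSwinnertonDyer.Theorems.GenusKolyTwin

end
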